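import Literature.Probability.LatticeModels.WilsonAlgorithm
import HarnessLib

/-!
# The discrete mixed Dirichlet–Neumann harmonic function ([LSW04] §4.1)

G. F. Lawler, O. Schramm, W. Werner, Ann. Probab. **32** (2004), §4.1, p. 973: "Let `H` be a
finite nonempty connected subgraph of `ℤ²` with vertices `V_H`, and let `E_∂` denote the set of
oriented edges in `ℤ²` whose initial endpoint is in `V_H`, but whose unoriented version is not in
`H`. Suppose `E_∂ = E₀ ∪ E₁ ∪ E₂` is a disjoint union, where `E₀ ∪ E₁ ≠ ∅`. […] For `v ∈ V_H` set
`Δ_{H,E₀,E₁,E₂} ĥ(v) := ∑ dĥ[v,u]`, where the sum is over all neighbors `u` of `v` in `ℤ²`, and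
`dĥ[v,u] := ĥ(u) − ĥ(v)` when `[v,u] ∉ E_∂`, `dĥ[v,u] := 0 − ĥ(v)` when `[v,u] ∈ E₀`,
`dĥ[v,u] := 1 − ĥ(v)` when `[v,u] ∈ E₁` and `dĥ[v,u] := 0` when `[v,u] ∈ E₂`. Note that there
is a unique `ĥ : V_H → [0,1]` such that `Δ_{H,E₀,E₁,E₂} ĥ(v) = 0` in `V_H`: `ĥ(v)` is the
probability that a simple random walk on `H ∪ E₀ ∪ E₁` started from `v` will use an edge in `E₁`
before using an edge of `E₀`. This `ĥ` will be called the `Δ_{H,E₀,E₁,E₂}`-harmonic function."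

We formalize this on a finite simple graph `H` with an absorbing **root set** `R` (the far
endpoints of the edges of `E₀ ∪ E₁`; in [LSW04] the vertices of `α`) and a predicate `good x r`
singling out the edges `x → r` of `E₁` (the edges of `E₂` are simply absent from `H`: Neumann =
reflection): the walk is the simple random walk on `H` stopped on hitting `R`
(`Forest.srw`, `WilsonAlgorithm.lean`).

* `Forest.entryMass H R good v` — the probability that the walk from `v` enters `R` through a
  good edge; `Forest.hhat` — the same as a real number, LSW's `ĥ`;
* `Forest.entryMass_step` — first-step analysis;
* `Forest.mixedLaplacian` — LSW's `Δ_{H,E₀,E₁,E₂}`, and `Forest.mixedLaplacian_hhat` — **`ĥ` is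
  `Δ`-harmonic** off `R`;
* `Forest.eq_of_mixedLaplacian_eq_zero` — **uniqueness** of the `Δ`-harmonic function off `R`
  when every vertex is joined to `R` (maximum principle);
* `Forest.ust_br_exists_endsWith_eq` — **by Wilson's algorithm**, under the uniform spanning
  forest rooted at `R` the probability that the branch from `v` enters `R` through a good edge is
  `ĥ(v)` ([LSW04] proof of Thm. 4.4: "`P[A]` […] is exactly `ĥ(v₀)`").
-/

noncomputable section

open scoped ENNReal Classical
open MeasureTheory
open Literature.Probability.RandomPlanarGeometry
open Literature.Probability.LatticeModels.LoopErasedWalkIdentity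
open Literature.Probability.LatticeModels.StoppedWalk

namespace Literature.Probability.LatticeModels

namespace Forest

variable {V : Type*} [Fintype V] [DecidableEq V]
variable (H : SimpleGraph V) (R : Finset V) (good : V → V → Prop)

/-! ### The entrance mass through good edges -/

/-- **The probability that simple random walk on `H` from `v`, stopped on hitting `R`, enters `R`
through an edge `x → r` with `good x r`** ("will use an edge in `E₁` before using an edge of
`E₀`"). [cite: LawlerSchrammWerner2004, §4.1 (p. 973)] -/
def entryMass (v : V) : ℝ≥0∞ :=
  wsum (srw H) v (fun t => IsStoppedAt (↑R : Set V) (v :: t) ∧ ∃ x r, good x r ∧ EndsWith x r (v :: t))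

variable {H R good}

omit [DecidableEq V] in
/-- From a root there is no entrance. [folklore] -/
theorem entryMass_eq_zero_of_mem {v : V} (hv : v ∈ R) : entryMass H R good v = 0 := by
  refine wsum_eq_zero _ fun t ht' => ?_
  obtain ⟨hst, x, r, -, u, hu⟩ := ht'
  have ht : t = [] := hst.eq_singleton_of_head_mem hv
  subst ht
  have := congrArg List.length hu
  simp at this

/-- The entrance mass is at most the hitting mass, hence at most `1`. [folklore] -/
theorem entryMass_le_one (v : V) : entryMass H R good v ≤ 1 := by
  by_cases hv : v ∈ R
  · rw [entryMass_eq_zero_of_mem hv]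
    exact zero_le_one
  · refine (wsum_mono (srw H) fun t ht => ?_).trans (hit_le_one (tsum_srw_le_one (H := H)) ↑R v)
    rcases (isStoppedAt_cons_iff (↑R : Set V) v t).1 ht.1 with ⟨h, -⟩ | ⟨-, h⟩
    · exact absurd h hv
    · exact h

/-- The entrance mass is finite. [folklore] -/
theorem entryMass_ne_top (v : V) : entryMass H R good v ≠ ⊤ :=
  ne_top_of_le_ne_top ENNReal.one_ne_top (entryMass_le_one v)

omit [Fintype V] [DecidableEq V] in
/-- The last step of a walk with at least one more vertex in front. [folklore] -/
theorem endsWith_cons_iff {x r v y : V} {t : List V} (ht : t ≠ []) :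
    EndsWith x r (v :: y :: t) ↔ EndsWith x r (y :: t) := by
  constructor
  · rintro ⟨u, hu⟩
    rcases u with _ | ⟨w, u⟩
    · simp only [List.nil_append, List.cons.injEq] at hu
      exact absurd hu.2.2 ht
    · simp only [List.cons_append, List.cons.injEq] at hu
      exact ⟨u, hu.2⟩
  · rintro ⟨u, hu⟩
    exact ⟨v :: u, by rw [hu]; rfl⟩

omit [Fintype V] [DecidableEq V] in
/-- The last step of a one-step walk. [folklore] -/
theorem endsWith_pair_iff {x r v y : V} : EndsWith x r [v, y] ↔ x = v ∧ r = y := by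
  constructor
  · intro h
    exact EndsWith.eq (u := []) (by simpa using h)
  · rintro ⟨rfl, rfl⟩
    exact ⟨[], rfl⟩

/-- **First-step analysis**: from `v ∉ R` the walk steps to a uniform neighbour `y`; a root `y`
ends the walk (through the edge `v → y`), an interior `y` restarts it.
[cite: LawlerSchrammWerner2004, §4.1 (p. 973)] -/
theorem entryMass_step {v : V} (hv : v ∉ R) :
    entryMass H R good v =
      ∑ y, srw H v y * (if y ∈ R then (if good v y then 1 else 0) else entryMass H R good y) := by
  rw [entryMass, wsum_step, if_neg, zero_add, tsum_fintype]
  swap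
  · rintro ⟨h, -⟩
    exact hv (by simpa using h.getLast_mem)
  refine Finset.sum_congr rfl fun y _ => ?_
  congr 1
  by_cases hy : y ∈ R
  · rw [if_pos hy]
    have key : ∀ t, (IsStoppedAt (↑R : Set V) (v :: y :: t) ∧
        ∃ x r, good x r ∧ EndsWith x r (v :: y :: t)) ↔ t = [] ∧ good v y := by
      intro t
      constructor
      · rintro ⟨hst, x, r, hg, hE⟩
        have hst' : IsStoppedAt (↑R : Set V) (y :: t) := by
          rcases (isStoppedAt_cons_iff (↑R : Set V) v (y :: t)).1 hst with ⟨-, h⟩ | ⟨-, h⟩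
          · exact absurd h (List.cons_ne_nil _ _)
          · exact h
        have ht : t = [] := hst'.eq_singleton_of_head_mem hy
        subst ht
        obtain ⟨rfl, rfl⟩ := endsWith_pair_iff.1 hE
        exact ⟨rfl, hg⟩
      · rintro ⟨rfl, hg⟩
        exact ⟨(isStoppedAt_singleton (by exact hy)).cons hv, v, y, hg, endsWith_pair_iff.2 ⟨rfl, rfl⟩⟩
    by_cases hg : good v y
    · rw [if_pos hg]
      exact wsum_eq_one_of_iff_nil _ fun t => (key t).trans (by simp [hg])
    · rw [if_neg hg]
      exact wsum_eq_zero _ fun t ht => hg ((key t).1 ht).2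
  · rw [if_neg hy, entryMass]
    refine wsum_congr _ fun t => ?_
    constructor
    · rintro ⟨hst, x, r, hg, hE⟩
      have hst' : IsStoppedAt (↑R : Set V) (y :: t) := by
        rcases (isStoppedAt_cons_iff (↑R : Set V) v (y :: t)).1 hst with ⟨-, h⟩ | ⟨-, h⟩
        · exact absurd h (List.cons_ne_nil _ _)
        · exact h
      have ht : t ≠ [] := fun ht ↦ hy (by subst ht; simpa using hst'.getLast_mem)
      exact ⟨hst', x, r, hg, (endsWith_cons_iff ht).1 hE⟩
    · rintro ⟨hst, x, r, hg, hE⟩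
      have ht : t ≠ [] := fun ht ↦ hy (by subst ht; simpa using hst.getLast_mem)
      exact ⟨hst.cons hv, x, r, hg, (endsWith_cons_iff ht).2 hE⟩

/-- First-step analysis along the edges of `H`:
`deg(v) · entryMass(v) = ∑_{u ∼ v} (root u ? [good v u] : entryMass u)`. [folklore] -/
theorem degree_mul_entryMass {v : V} (hv : v ∉ R) :
    (H.degree v : ℝ≥0∞) * entryMass H R good v =
      ∑ u ∈ H.neighborFinset v, (if u ∈ R then (if good v u then 1 else 0) else entryMass H R good u) := by
  rw [entryMass_step hv]
  by_cases hd : H.degree v = 0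
  · have hempty : H.neighborFinset v = ∅ := by
      rw [← Finset.card_eq_zero, SimpleGraph.card_neighborFinset_eq_degree, hd]
    rw [hempty, Finset.sum_empty]
    refine (mul_eq_zero.2 (Or.inr ?_))
    refine Finset.sum_eq_zero fun y _ => ?_
    have : ¬ H.Adj v y := fun h ↦ by
      have : y ∈ H.neighborFinset v := (SimpleGraph.mem_neighborFinset _ _ _).2 h
      rw [hempty] at this
      simp at this
    simp [srw, this]
  · have hsum : ∑ y, srw H v y * (if y ∈ R then (if good v y then 1 else 0) else entryMass H R good y) =
        ((H.degree v : ℝ≥0∞))⁻¹ *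
          ∑ u ∈ H.neighborFinset v, (if u ∈ R then (if good v u then 1 else 0) else entryMass H R good u) := by
      rw [Finset.mul_sum, SimpleGraph.neighborFinset_eq_filter (v := v), Finset.sum_filter]
      refine Finset.sum_congr rfl fun y _ => ?_
      by_cases h : H.Adj v y
      · simp [srw, h]
      · simp [srw, h]
    rw [hsum, ← mul_assoc, ENNReal.mul_inv_cancel (by exact_mod_cast hd) (ENNReal.natCast_ne_top _),
      one_mul]

/-! ### LSW's `ĥ` and the mixed Laplacian -/

variable (H R good)

/-- **LSW's `ĥ`**: the entrance probability through the good edges, as a real number in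
`[0, 1]`. [cite: LawlerSchrammWerner2004, §4.1 (p. 973)] -/
def hhat (v : V) : ℝ := (entryMass H R good v).toReal

/-- **LSW's mixed Laplacian `Δ_{H,E₀,E₁,E₂}`**: `∑_u dĥ[v,u]` over the neighbours `u` of `v` in
`H ∪ E₀ ∪ E₁` (the root neighbours are the far endpoints of the edges of `E₀ ∪ E₁`; the edges of
`E₂` contribute `0` and are omitted), with `dĥ[v,u] = ĥ(u) − ĥ(v)` for an interior `u`,
`1 − ĥ(v)` for a good root edge and `0 − ĥ(v)` for the other root edges.
[cite: LawlerSchrammWerner2004, §4.1 (p. 973)] -/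
def mixedLaplacian (f : V → ℝ) (v : V) : ℝ :=
  ∑ u ∈ H.neighborFinset v, ((if u ∈ R then (if good v u then 1 else 0) else f u) - f v)

variable {H R good}

omit [DecidableEq V] in
/-- `0 ≤ ĥ`. [folklore] -/
theorem hhat_nonneg (v : V) : 0 ≤ hhat H R good v := ENNReal.toReal_nonneg

/-- `ĥ ≤ 1`. [folklore] -/
theorem hhat_le_one (v : V) : hhat H R good v ≤ 1 := by
  have := ENNReal.toReal_mono ENNReal.one_ne_top (entryMass_le_one (H := H) (R := R) (good := good) v)
  simpa [hhat] using this

omit [DecidableEq V] in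
/-- `ĥ` vanishes on the roots. [folklore] -/
theorem hhat_eq_zero_of_mem {v : V} (hv : v ∈ R) : hhat H R good v = 0 := by
  simp [hhat, entryMass_eq_zero_of_mem hv]

/-- **`ĥ` is `Δ_{H,E₀,E₁,E₂}`-harmonic** at every vertex off the roots.
[cite: LawlerSchrammWerner2004, §4.1 (p. 973)] -/
theorem mixedLaplacian_hhat {v : V} (hv : v ∉ R) : mixedLaplacian H R good (hhat H R good) v = 0 := by
  have key := congrArg ENNReal.toReal (degree_mul_entryMass (H := H) (R := R) (good := good) hv)
  rw [ENNReal.toReal_mul, ENNReal.toReal_natCast, ENNReal.toReal_sum] at key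
  swap
  · intro u _
    split_ifs
    · exact ENNReal.one_ne_top
    · exact ENNReal.zero_ne_top
    · exact entryMass_ne_top u
  have key' : (H.degree v : ℝ) * hhat H R good v =
      ∑ u ∈ H.neighborFinset v, (if u ∈ R then (if good v u then (1 : ℝ) else 0) else hhat H R good u) := by
    rw [hhat, key]
    refine Finset.sum_congr rfl fun u _ => ?_
    split_ifs <;> simp [hhat]
  rw [mixedLaplacian, Finset.sum_sub_distrib, Finset.sum_const, SimpleGraph.card_neighborFinset_eq_degree,
    nsmul_eq_mul, ← key', sub_self]

/-! ### Uniqueness: the maximum principle -/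

omit [DecidableEq V] in
/-- **Maximum principle**: a function vanishing on `R` whose value at each vertex off `R` is the
average of its neighbours' values is `≤ 0` everywhere, when every vertex is joined to `R`.
[folklore] -/
theorem le_zero_of_meanValue (hR : ReachesRoot H R) {d : V → ℝ} (hd0 : ∀ v ∈ R, d v = 0)
    (hmv : ∀ v, v ∉ R → (H.degree v : ℝ) * d v = ∑ u ∈ H.neighborFinset v, d u) :
    ∀ v, d v ≤ 0 := by
  by_contra hcon
  simp only [not_forall, not_le] at hcon
  obtain ⟨v₁, hv₁⟩ := hcon
  obtain ⟨v₀, -, hmax⟩ := Finset.exists_max_image Finset.univ d ⟨v₁, Finset.mem_univ _⟩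
  have hM : 0 < d v₀ := hv₁.trans_le (hmax v₁ (Finset.mem_univ _))
  -- the maximum propagates to the neighbours of a non-root maximiser
  have hprop : ∀ v, d v = d v₀ → ∀ u, H.Adj v u → d u = d v₀ := by
    intro v hv u hu
    have hvR : v ∉ R := fun h ↦ by rw [hd0 v h] at hv; exact hM.ne hv
    have h1 := hmv v hvR
    have hle : ∀ w ∈ H.neighborFinset v, d w ≤ d v₀ := fun w _ ↦ hmax w (Finset.mem_univ _)
    have hsum_le : ∑ w ∈ H.neighborFinset v, d w ≤ ∑ w ∈ H.neighborFinset v, d v₀ :=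
      Finset.sum_le_sum hle
    have hsum_eq : ∑ w ∈ H.neighborFinset v, d w = ∑ w ∈ H.neighborFinset v, d v₀ := by
      refine le_antisymm hsum_le ?_
      rw [Finset.sum_const, SimpleGraph.card_neighborFinset_eq_degree, nsmul_eq_mul, ← hv, ← h1]
    have := (Finset.sum_eq_sum_iff_of_le hle).1 hsum_eq u ((SimpleGraph.mem_neighborFinset _ _ _).2 hu)
    exact this
  -- follow a path from the maximiser to a root
  have hv₀R : v₀ ∉ R := fun h ↦ by rw [hd0 v₀ h] at hM; exact lt_irrefl _ hM
  obtain ⟨r, hr, ⟨p⟩⟩ := hR v₀ hv₀R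
  have hend : d r = d v₀ := by
    suffices ∀ (x y : V) (q : H.Walk x y), d x = d v₀ → d y = d v₀ from this v₀ r p rfl
    intro x y q
    induction q with
    | nil => exact id
    | cons hadj q ih => exact fun hx ↦ ih (hprop _ hx _ hadj)
  rw [hd0 r hr] at hend
  exact hM.ne hend

/-- **Uniqueness of the `Δ_{H,E₀,E₁,E₂}`-harmonic function** ("there is a unique `ĥ`"): two
functions which are `Δ`-harmonic off `R` agree off `R`, provided every vertex is joined to `R`
in `H` (e.g. `H` connected and `R` nonempty). [cite: LawlerSchrammWerner2004, §4.1 (p. 973)] -/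
theorem eq_of_mixedLaplacian_eq_zero (hR : ReachesRoot H R) {f g : V → ℝ}
    (hf : ∀ v, v ∉ R → mixedLaplacian H R good f v = 0)
    (hg : ∀ v, v ∉ R → mixedLaplacian H R good g v = 0) : ∀ v, v ∉ R → f v = g v := by
  set d : V → ℝ := fun v ↦ if v ∈ R then 0 else f v - g v with hd
  have hd0 : ∀ v ∈ R, d v = 0 := fun v hv ↦ by simp [hd, hv]
  have hmv : ∀ v, v ∉ R → (H.degree v : ℝ) * d v = ∑ u ∈ H.neighborFinset v, d u := by
    intro v hv
    have h1 := hf v hv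
    have h2 := hg v hv
    simp only [mixedLaplacian, Finset.sum_sub_distrib, Finset.sum_const,
      SimpleGraph.card_neighborFinset_eq_degree, nsmul_eq_mul, sub_eq_zero] at h1 h2
    simp only [hd, if_neg hv, mul_sub, h1.symm, h2.symm, ← Finset.sum_sub_distrib]
    refine Finset.sum_congr rfl fun u _ => ?_
    split_ifs <;> ring
  have hle := le_zero_of_meanValue hR hd0 hmv
  have hge := le_zero_of_meanValue hR (d := fun v ↦ -d v) (fun v hv ↦ by simp [hd0 v hv])
    (fun v hv ↦ by rw [mul_neg, hmv v hv, Finset.sum_neg_distrib])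
  intro v hv
  have h1 := hle v
  have h2 := hge v
  simp only [hd, if_neg hv, neg_nonpos] at h1 h2
  linarith

/-- **`ĥ` is the unique `Δ_{H,E₀,E₁,E₂}`-harmonic function**: any `Δ`-harmonic function off `R`
is the entrance probability through the good edges. [cite: LawlerSchrammWerner2004, §4.1 (p. 973)] -/
theorem eq_hhat_of_mixedLaplacian_eq_zero (hR : ReachesRoot H R) {f : V → ℝ}
    (hf : ∀ v, v ∉ R → mixedLaplacian H R good f v = 0) : ∀ v, v ∉ R → f v = hhat H R good v :=
  eq_of_mixedLaplacian_eq_zero hR hf fun _ hv ↦ mixedLaplacian_hhat hv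

/-! ### By Wilson's algorithm: the branch enters through a good edge with probability `ĥ` -/

/-- Pemantle's theorem in push-forward measure form (a copy of `Forest.ust_br_pred_eq` of
`USTPeanoTreeLaw.lean`, which is downstream of this file). [cite: LyonsPeres2016, Corollary 4.3] -/
private theorem ust_br_pred_eq' (h : ReachesRoot H R) {v : V} (hv : v ∉ R) (P : List V → Prop) :
    ust H R {F | P (F.br v)} =
      wsum (srw H) v (fun t => IsStoppedAt (↑R : Set V) (v :: t) ∧ P (loopErase (afterLast v t))) := by
  rw [ust, ProbabilityTheory.uniformOn_univ, Measure.count_apply_finite _ (Set.toFinite _)]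
  have hcard : ((Set.toFinite {F : Forest H R | P (F.br v)}).toFinset.card : ℝ≥0∞) =
      ((Finset.univ.filter fun F : Forest H R => P (F.br v)).card : ℝ≥0∞) := by
    congr 2
    ext F
    simp
  rw [hcard, card_filter_br_pred_eq h hv P, mul_comm, mul_div_assoc,
    ENNReal.div_self (by exact_mod_cast (card_pos h).ne') (ENNReal.natCast_ne_top _), mul_one]

/-- **"By Wilson's algorithm, `P[A]` […] is exactly `ĥ(v₀)`"**: under the uniform spanning forest
of `H` rooted at `R`, the probability that the branch from `v ∉ R` enters `R` through a good edge
is the probability that simple random walk from `v` stopped at `R` does, i.e. `ĥ(v)`.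
[cite: LawlerSchrammWerner2004, Theorem 4.4 (proof, p. 975)] -/
theorem ust_br_exists_endsWith_eq (h : ReachesRoot H R) {v : V} (hv : v ∉ R) :
    ust H R {F | ∃ x r, good x r ∧ EndsWith x r (v :: F.br v)} = entryMass H R good v := by
  rw [ust_br_pred_eq' h hv (fun L => ∃ x r, good x r ∧ EndsWith x r (v :: L)), entryMass]
  refine wsum_congr _ fun t => ?_
  constructor
  · rintro ⟨hst, x, r, hg, hE⟩
    refine ⟨hst, x, r, hg, (endsWith_loopErase_iff hv hst x r).1 ?_⟩
    rwa [loopErase_cons]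
  · rintro ⟨hst, x, r, hg, hE⟩
    refine ⟨hst, x, r, hg, ?_⟩
    rw [← loopErase_cons]
    exact (endsWith_loopErase_iff hv hst x r).2 hE

/-- The same for the real-valued `ĥ`. [cite: LawlerSchrammWerner2004, Theorem 4.4 (proof, p. 975)] -/
theorem ust_real_br_exists_endsWith_eq (h : ReachesRoot H R) {v : V} (hv : v ∉ R) :
    (ust H R).real {F | ∃ x r, good x r ∧ EndsWith x r (v :: F.br v)} = hhat H R good v := by
  rw [measureReal_def, ust_br_exists_endsWith_eq h hv, hhat]

end Forest

end Literature.Probability.LatticeModels
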